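import Summits.QuantumFields.YangMills.Theorems.SwapVirialDeficitSectorLaplaceBulkTwoSidedLaw
import Summits.QuantumFields.YangMills.Theorems.SwapVirialDeficitLocalTwoSidedStiffness
import HarnessLib

/-!
# (S)-road ➎, stub (S-bulk) part 3: ★★★ THE BULK STIFFNESS WITH SURPLUS — `stub_bulk_stiff_sur` of skeleton ➎ BY SHAPE
# (free-hands support of ⟨stmt-QuantumFields-24197⟩ `SwapVirialDeficit.SwapGluedStiffness`; cell ym-idea-1, LEAD g98 memo6 ∕ 19:15Z re-cut, assembler fcl-p3 g47)

Per good sign pattern `ε`: the two-sided log law of part 2 (✓`bulk_logLaw`) at `b` (lower) and at `(1 + h)b`, `h = 1∕(40L⁴)` (upper), with the common constant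
`C_ε = α log 2π + log M_ε`, fed to LEAD g98's ✓`setStiffness_of_twoSided_logLaplace` on `(chartMeasure L, HubBulk τ × fibre, F̂_ε)`, gives
`(α∕(1+h) − (E₁+E₂)∕h)·Z_ε(b) ≤ b·E_ε(b)`; with `E₁ + E₂ ≤ 3∕(20000L⁴)` the constant exceeds `κ_L + 1∕16 = 9L⁴ − 3∕2 + 1∕8 + 1∕16` (`stiff_budget`).  Summing over the good
patterns: ★★★ `bulk_stiff_sur` — `∃ K > 0, k, τ₀ = ½: ∀ L, ∀ 0 < τ ≤ τ₀∕L^k, ∀ b ≥ K·L^k·τ^{−k}`,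
`(stiffKappa L (1∕8) + 1∕16)·Σ_good ∫_{HubBulk τ} I ≤ b·Σ_good ∫_{HubBulk τ} E` = the stub `stub_bulk_stiff_sur` of HOME `fcl-p3-g47-SectorStiffnessSkeleton.lean` VERBATIM.
Inputs: w2 g59 ✓`bulk_fibred_plane` (E1 rescaled fibred Laplace law), ✓`integrableOn_integral_mbDensity_hubBulk` (S3 on the bulk), ✓`twoSided_logLaw_of_relative`; LEAD g98
✓`setStiffness_of_twoSided_logLaplace`; parts 1–2 (✓`bulkMass_pos`, ✓`bulk_logLaw`); ✓`bulk_exp_chart_eq` ∕ ✓`bulk_action_chart_eq`.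

* §1 `stiff_budget` (the constant), `chartMeasure_bulk_ne_zero`, threshold arithmetic (`bulk_thresholds`);
* §2 ★★ `bulk_stiff_sur_sign` — one good sign pattern at fixed `L, τ, b`;  §3 ★★★ `bulk_stiff_sur`.

HONEST LABEL: closes the bulk stub of ➎ UNCONDITIONALLY (no hypotheses beyond landed theorems); the B-tube stub, the core weight stub and sector 001 remain OPEN, so
⟨24197⟩ ∕ ⟨24194⟩ are OPEN; ⟨24196⟩ proved elsewhere; item of record ⟨24085⟩ SubOctaveBounded aside ∕ untouched; the Yang–Mills mass gap is NOT proved; no summit is proved by a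
line.  THEOREMS ONLY (0 `def`, 0 `sorry`), standard axioms; the `attribute [local instance]` block is the chart's measurable structure on `ℍ` (as in ✓`SectorLaplaceDefs`; nothing
overridden).  Seat ym-line-fcl-p3 g47 (cell ym-idea-1, free hands), `--supports stmt-QuantumFields-24197`.  References: [cite: Luscher1983, §2]; [cite: Griffiths1964]; [folklore].
-/

set_option autoImplicit false
set_option synthInstance.maxSize 1024

noncomputable section

open MeasureTheory Quaternion Set
open scoped Quaternion BigOperators ENNReal
open Literature.MathematicalPhysics.QuantumLattice
open Literature.MathematicalPhysics.QuantumFieldTheory hiding SU2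
open Summit.QuantumFields.YangMills.Theorems.SwapTwistDeficit.ToronLog

attribute [local instance] Literature.Analysis.FluidPDE.Tao2016.quatMeasurableSpace
  Literature.Analysis.FluidPDE.Tao2016.quatBorelSpace
  Literature.MathematicalPhysics.QuantumLattice.secondCountableTopology_su2

namespace Summit.QuantumFields.YangMills.Theorems.SwapVirialDeficit.SectorLaplace

open Summit.QuantumFields.YangMills.Theorems.FemtoTransferGap
open Summit.QuantumFields.YangMills.Theorems.FemtoTransferGap.TT
open Summit.QuantumFields.YangMills.Theorems.VirialFluxGap.RingDeficit
open Summit.QuantumFields.YangMills.Theorems.SwapVirialDeficit.SwapRing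
open Summit.QuantumFields.YangMills.Theorems.SwapVirialDeficit.BlowUpRing

variable {L : ℕ} [NeZero L]

/-! ## §1 The constant, the region, the thresholds -/

/-- ★ THE BUDGET: with `h = 1∕(40L⁴)` and `E₁ + E₂ ≤ 3∕(20000L⁴)`, `κ_L + 1∕16 ≤ α∕(1+h) − (E₁+E₂)∕h` (`α = 9L⁴ − 1`, `κ_L = 9L⁴ − 3∕2 + 1∕8`). [folklore] -/
theorem stiff_budget {E : ℝ} (hE : E ≤ 3 / (20000 * (L : ℝ) ^ 4)) :
    stiffKappa L (1 / 8) + 1 / 16 ≤ alpha L / (1 + 1 / (40 * (L : ℝ) ^ 4)) - E / (1 / (40 * (L : ℝ) ^ 4)) := by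
  have hL1 : (1 : ℝ) ≤ L := by exact_mod_cast NeZero.one_le
  have hu : (1 : ℝ) ≤ (L : ℝ) ^ 4 := one_le_pow₀ hL1
  set u : ℝ := (L : ℝ) ^ 4 with hudef
  have hu0 : 0 < u := by linarith
  have hα : alpha L = 9 * u - 1 := by rw [hudef]; unfold alpha; exact finrank_gnoFibre_real_div_two
  have hκ : stiffKappa L (1 / 8) = 9 * u - 3 / 2 + 1 / 8 := rfl
  rw [hα, hκ]
  -- `(9u−1)/(1+h) ≥ (9u−1)(1−h) = 9u − 1 − 9/40 + 1/(40u) ≥ 9u − 1.225`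
  have h1 : (9 * u - 1) * (1 - 1 / (40 * u)) ≤ (9 * u - 1) / (1 + 1 / (40 * u)) := by
    rw [le_div_iff₀ (by positivity)]
    have h9 : 0 ≤ 9 * u - 1 := by linarith
    have hh : (1 - 1 / (40 * u)) * (1 + 1 / (40 * u)) ≤ 1 := by nlinarith [sq_nonneg (1 / (40 * u))]
    calc (9 * u - 1) * (1 - 1 / (40 * u)) * (1 + 1 / (40 * u)) = (9 * u - 1) * ((1 - 1 / (40 * u)) * (1 + 1 / (40 * u))) := by ring
      _ ≤ (9 * u - 1) * 1 := mul_le_mul_of_nonneg_left hh h9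
      _ = 9 * u - 1 := mul_one _
  have h2 : 9 * u - 1 - 9 / 40 ≤ (9 * u - 1) * (1 - 1 / (40 * u)) := by
    have e : (9 * u - 1) * (1 - 1 / (40 * u)) = 9 * u - 1 - 9 / 40 + 1 / (40 * u) := by field_simp; ring
    rw [e]; have : 0 ≤ 1 / (40 * u) := by positivity
    linarith
  -- `E/h = 40uE ≤ 0.006`
  have h3 : E / (1 / (40 * u)) ≤ 6 / 1000 := by
    rw [div_div_eq_mul_div, div_one]
    calc E * (40 * u) ≤ 3 / (20000 * u) * (40 * u) := mul_le_mul_of_nonneg_right hE (by positivity)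
      _ = 6 / 1000 := by field_simp; ring
  linarith

/-- The bulk region has positive chart measure. [folklore] -/
theorem chartMeasure_bulk_ne_zero {τ : ℝ} (hτ1 : τ ≤ 1 / 2) : chartMeasure L (HubBulk τ ×ˢ (univ : Set (GnoCoord L))) ≠ 0 := by
  haveI := isProbabilityMeasure_coneMeasure
  haveI := isFiniteMeasure_fibreMeasure (L := L)
  have e : chartMeasure L (HubBulk τ ×ˢ (univ : Set (GnoCoord L))) = coneMeasure (HubBulk τ) * fibreMeasure L univ := by
    unfold chartMeasure; rw [Measure.prod_prod]
  rw [e]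
  refine mul_ne_zero ?_ ?_
  · intro h0
    have h1 : coneMeasure.real (HubBulk (1 / 2)) ≤ coneMeasure.real (HubBulk τ) := measureReal_mono (hubBulk_mono hτ1)
    rw [measureReal_def (s := HubBulk τ), h0, ENNReal.toReal_zero] at h1
    exact absurd h1 (not_le.2 coneMeasure_hubBulk_half_pos)
  · intro h0
    have h2 : (∫ _η : GnoCoord L, (1 : ℝ) ∂fibreMeasure L) = ∫ η : GnoCoord L, (1 : ℝ) * gnoDensity η := integral_fibreMeasure (fun _ => (1 : ℝ))
    have h3 : (∫ _η : GnoCoord L, (1 : ℝ) ∂fibreMeasure L) = 0 := by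
      rw [integral_const, smul_eq_mul, mul_one, measureReal_def, h0, ENNReal.toReal_zero]
    have h1 : ∫ η : GnoCoord L, gnoDensity η = 0 := by
      have h4 := h2.symm.trans h3
      simpa only [one_mul] using h4
    have hpos : 0 < ∫ η : GnoCoord L, gnoDensity η := by
      have htot := gnomonic_total_mass_real (L := L) (χ := fun _ => (1 : SU2)) one_central
      have hKL0 : 0 < KL L := lt_of_lt_of_le (Real.exp_pos _) KL_floor
      have hcard : 0 < (Fintype.card (GnoSign L) : ℝ) := by exact_mod_cast Fintype.card_pos
      have hsum : ∑ _ε : GnoSign L, ∫ η : GnoCoord L, gnoDensity η = (Fintype.card (GnoSign L) : ℝ) * ∫ η : GnoCoord L, gnoDensity η := by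
        rw [Finset.sum_const, Finset.card_univ, nsmul_eq_mul]
      have e1 : KL L * ((Fintype.card (GnoSign L) : ℝ) * ∫ η : GnoCoord L, gnoDensity η) = 1 := by rw [← hsum]; unfold KL; exact htot
      have h4 : 0 < (Fintype.card (GnoSign L) : ℝ) * ∫ η : GnoCoord L, gnoDensity η := (mul_pos_iff_of_pos_left hKL0).1 (by rw [e1]; exact one_pos)
      exact (mul_pos_iff_of_pos_left hcard).1 h4
    rw [h1] at hpos
    exact lt_irrefl _ hpos

omit [NeZero L] in
/-- THE THRESHOLD ARITHMETIC: from `P⁴ ≤ t` with `P = D·L^d·τ⁻¹^{k₂}` (`D ≥ 40000`, `D ≥ (K₂+1)^{k₂+1}`, `D ≥ A + 40`, `d ≥ 12 + k₂ + k₂²`, `L ≥ 1`, `τ⁻¹ ≥ 2`) all the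
conditions of ✓`bulk_logLaw` hold at `t`, and `r + x ≤ 1∕(20000L⁴)`. [folklore] -/
theorem bulk_thresholds {K₂ A τ t : ℝ} {k₂ : ℕ} (hK₂ : 0 < K₂) (hA : 0 ≤ A) (hτ : 0 < τ) (hτ1 : τ ≤ 1 / 2)
    (hL1 : (1 : ℝ) ≤ L)
    (ht : (40000 * (K₂ + 1) ^ (k₂ + 1) * (A + 40) * (L : ℝ) ^ (12 + k₂ + k₂ * k₂) * τ⁻¹ ^ k₂) ^ 4 ≤ t) :
    1 ≤ t ∧ (K₂ * (L : ℝ) ^ k₂ * (1 / τ) ^ k₂) ^ 2 ≤ t ∧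
      t ^ (1 / 4 : ℝ) * (4 * (9 * (L : ℝ) ^ 4 + 1) + A) ≤ t * (τ / (K₂ * (L : ℝ) ^ k₂)) ^ k₂ ∧
        K₂ * (L : ℝ) ^ k₂ * (1 / τ) ^ k₂ * t ^ (-(1 / 2 : ℝ)) + t ^ (-(1 / 4 : ℝ)) ≤ 1 / (20000 * (L : ℝ) ^ 4) := by
  set D : ℝ := 40000 * (K₂ + 1) ^ (k₂ + 1) * (A + 40) with hD
  set d : ℕ := 12 + k₂ + k₂ * k₂ with hd
  set P : ℝ := D * (L : ℝ) ^ d * τ⁻¹ ^ k₂ with hP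
  have hL0 : (0 : ℝ) < L := by linarith
  have hτi : 2 ≤ τ⁻¹ := by
    rw [le_inv_comm₀ (by norm_num) hτ]
    have : (2 : ℝ)⁻¹ = 1 / 2 := by norm_num
    rw [this]; exact hτ1
  have hτi1 : 1 ≤ τ⁻¹ := by linarith
  have hK1 : 1 ≤ K₂ + 1 := by linarith
  have hKpow : 1 ≤ (K₂ + 1) ^ (k₂ + 1) := one_le_pow₀ hK1
  have hA40 : 40 ≤ A + 40 := by linarith
  have hD1 : 40000 ≤ D := by
    rw [hD]; nlinarith [hKpow, hA40, mul_le_mul hKpow hA40 (by norm_num) (by positivity)]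
  have hLd : (1 : ℝ) ≤ (L : ℝ) ^ d := one_le_pow₀ hL1
  have hτk : (1 : ℝ) ≤ τ⁻¹ ^ k₂ := one_le_pow₀ hτi1
  have hP1 : 40000 ≤ P := by
    rw [hP]
    calc (40000 : ℝ) = 40000 * 1 * 1 := by ring
      _ ≤ D * (L : ℝ) ^ d * τ⁻¹ ^ k₂ := mul_le_mul (mul_le_mul hD1 hLd (by norm_num) (by linarith)) hτk (by norm_num) (by positivity)
  have hP0 : 0 < P := by linarith
  have hPone : 1 ≤ P := by linarith
  have hP4t : P ^ 4 ≤ t := ht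
  have ht1 : 1 ≤ t := le_trans (one_le_pow₀ hPone) hP4t
  have ht0 : 0 < t := by linarith
  -- `K₂ L^{k₂} τ⁻¹^{k₂} ≤ P`
  have hL4 : (L : ℝ) ^ 4 ≤ P := by
    rw [hP]
    calc (L : ℝ) ^ 4 = 1 * (L : ℝ) ^ 4 * 1 := by ring
      _ ≤ D * (L : ℝ) ^ d * τ⁻¹ ^ k₂ :=
          mul_le_mul (mul_le_mul (by linarith) (pow_le_pow_right₀ hL1 (by omega)) (by positivity) (by linarith)) hτk (by norm_num) (by positivity)
  have hr_le : K₂ * (L : ℝ) ^ k₂ * (1 / τ) ^ k₂ ≤ P := by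
    rw [one_div, hP]
    have hK₂D : K₂ ≤ D := by
      rw [hD]
      have : K₂ ≤ (K₂ + 1) ^ (k₂ + 1) := by
        calc K₂ ≤ K₂ + 1 := by linarith
          _ = (K₂ + 1) ^ 1 := (pow_one _).symm
          _ ≤ (K₂ + 1) ^ (k₂ + 1) := pow_le_pow_right₀ hK1 (by omega)
      nlinarith [this, hKpow, hA40]
    exact mul_le_mul (mul_le_mul hK₂D (pow_le_pow_right₀ hL1 (by omega)) (by positivity) (by linarith)) le_rfl (by positivity) (by positivity)
  -- (ii) the plane law's threshold
  have hii : (K₂ * (L : ℝ) ^ k₂ * (1 / τ) ^ k₂) ^ 2 ≤ t := by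
    calc (K₂ * (L : ℝ) ^ k₂ * (1 / τ) ^ k₂) ^ 2 ≤ P ^ 2 := pow_le_pow_left₀ (by positivity) hr_le 2
      _ ≤ P ^ 4 := pow_le_pow_right₀ hPone (by norm_num)
      _ ≤ t := hP4t
  -- (iii) absorption: `t^{1/4}·Y ≤ t·c` with `Y·(K₂L^{k₂}/τ)^{k₂} ≤ P³ ≤ t^{3/4}`
  have hY : 4 * (9 * (L : ℝ) ^ 4 + 1) + A ≤ (A + 40) * (L : ℝ) ^ 8 := by
    have hL8 : (L : ℝ) ^ 4 ≤ (L : ℝ) ^ 8 := pow_le_pow_right₀ hL1 (by norm_num)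
    have hL8' : (1 : ℝ) ≤ (L : ℝ) ^ 8 := one_le_pow₀ hL1
    nlinarith
  have hQ : (K₂ * (L : ℝ) ^ k₂ / τ) ^ k₂ = K₂ ^ k₂ * (L : ℝ) ^ (k₂ * k₂) * τ⁻¹ ^ k₂ := by
    rw [div_eq_mul_inv, mul_pow, mul_pow, ← pow_mul]
  have hprod : ((A + 40) * (L : ℝ) ^ 8) * (K₂ ^ k₂ * (L : ℝ) ^ (k₂ * k₂) * τ⁻¹ ^ k₂) ≤ P ^ 3 := by
    -- three factors each `≤ P`: `(A+40)L⁸`, `K₂^{k₂} L^{k₂²}`, `τ⁻¹^{k₂}`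
    have f1 : (A + 40) * (L : ℝ) ^ 8 ≤ P := by
      rw [hP]
      have : A + 40 ≤ D := by rw [hD]; nlinarith [hKpow, hA40]
      calc (A + 40) * (L : ℝ) ^ 8 = (A + 40) * (L : ℝ) ^ 8 * 1 := (mul_one _).symm
        _ ≤ D * (L : ℝ) ^ d * τ⁻¹ ^ k₂ := mul_le_mul (mul_le_mul this (pow_le_pow_right₀ hL1 (by omega)) (by positivity) (by linarith)) hτk
            (by norm_num) (by positivity)
    have f2 : K₂ ^ k₂ * (L : ℝ) ^ (k₂ * k₂) ≤ P := by
      rw [hP]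
      have : K₂ ^ k₂ ≤ D := by
        rw [hD]
        have h5 : K₂ ^ k₂ ≤ (K₂ + 1) ^ (k₂ + 1) := by
          calc K₂ ^ k₂ ≤ (K₂ + 1) ^ k₂ := pow_le_pow_left₀ hK₂.le (by linarith) _
            _ ≤ (K₂ + 1) ^ (k₂ + 1) := pow_le_pow_right₀ hK1 (by omega)
        nlinarith [h5, hKpow, hA40, pow_nonneg hK₂.le k₂]
      calc K₂ ^ k₂ * (L : ℝ) ^ (k₂ * k₂) = K₂ ^ k₂ * (L : ℝ) ^ (k₂ * k₂) * 1 := (mul_one _).symm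
        _ ≤ D * (L : ℝ) ^ d * τ⁻¹ ^ k₂ := mul_le_mul (mul_le_mul this (pow_le_pow_right₀ hL1 (by omega)) (by positivity) (by linarith)) hτk
            (by norm_num) (by positivity)
    have f3 : τ⁻¹ ^ k₂ ≤ P := by
      rw [hP]
      calc τ⁻¹ ^ k₂ = 1 * 1 * τ⁻¹ ^ k₂ := by ring
        _ ≤ D * (L : ℝ) ^ d * τ⁻¹ ^ k₂ := mul_le_mul_of_nonneg_right (mul_le_mul (by linarith) hLd (by norm_num) (by linarith)) (by positivity)
    have g0 : 0 ≤ (A + 40) * (L : ℝ) ^ 8 := by positivity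
    have g1 : 0 ≤ K₂ ^ k₂ * (L : ℝ) ^ (k₂ * k₂) := by positivity
    calc ((A + 40) * (L : ℝ) ^ 8) * (K₂ ^ k₂ * (L : ℝ) ^ (k₂ * k₂) * τ⁻¹ ^ k₂)
        = ((A + 40) * (L : ℝ) ^ 8) * (K₂ ^ k₂ * (L : ℝ) ^ (k₂ * k₂)) * τ⁻¹ ^ k₂ := by ring
      _ ≤ P * P * P := mul_le_mul (mul_le_mul f1 f2 g1 hP0.le) f3 (by positivity) (by positivity)
      _ = P ^ 3 := by ring
  have h34 : P ^ 3 ≤ t ^ (3 / 4 : ℝ) := by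
    have h := Real.rpow_le_rpow (by positivity) hP4t (by norm_num : (0 : ℝ) ≤ 3 / 4)
    have e : (P ^ 4) ^ (3 / 4 : ℝ) = P ^ 3 := by
      rw [← Real.rpow_natCast P 4, ← Real.rpow_mul hP0.le, show ((4 : ℕ) : ℝ) * (3 / 4 : ℝ) = ((3 : ℕ) : ℝ) by norm_num, Real.rpow_natCast]
    rw [e] at h; exact h
  have hiii : t ^ (1 / 4 : ℝ) * (4 * (9 * (L : ℝ) ^ 4 + 1) + A) ≤ t * (τ / (K₂ * (L : ℝ) ^ k₂)) ^ k₂ := by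
    have hc0 : 0 < (K₂ * (L : ℝ) ^ k₂ / τ) ^ k₂ := by positivity
    have ec : (τ / (K₂ * (L : ℝ) ^ k₂)) ^ k₂ = ((K₂ * (L : ℝ) ^ k₂ / τ) ^ k₂)⁻¹ := by
      rw [← inv_pow, inv_div]
    rw [ec, ← div_eq_mul_inv, le_div_iff₀ hc0]
    have et : t = t ^ (1 / 4 : ℝ) * t ^ (3 / 4 : ℝ) := by
      rw [← Real.rpow_add ht0]; norm_num
    calc t ^ (1 / 4 : ℝ) * (4 * (9 * (L : ℝ) ^ 4 + 1) + A) * (K₂ * (L : ℝ) ^ k₂ / τ) ^ k₂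
        ≤ t ^ (1 / 4 : ℝ) * (((A + 40) * (L : ℝ) ^ 8) * (K₂ ^ k₂ * (L : ℝ) ^ (k₂ * k₂) * τ⁻¹ ^ k₂)) := by
          rw [mul_assoc, hQ]
          exact mul_le_mul_of_nonneg_left (mul_le_mul_of_nonneg_right hY (by positivity)) (Real.rpow_nonneg ht0.le _)
      _ ≤ t ^ (1 / 4 : ℝ) * t ^ (3 / 4 : ℝ) := mul_le_mul_of_nonneg_left (hprod.trans h34) (Real.rpow_nonneg ht0.le _)
      _ = t := et.symm
  -- (iv) `r + x ≤ 2/P ≤ 1/(20000L⁴)`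
  have hiv : K₂ * (L : ℝ) ^ k₂ * (1 / τ) ^ k₂ * t ^ (-(1 / 2 : ℝ)) + t ^ (-(1 / 4 : ℝ)) ≤ 1 / (20000 * (L : ℝ) ^ 4) := by
    have hPt : P ≤ t ^ (1 / 4 : ℝ) := by
      have h := Real.rpow_le_rpow (by positivity) hP4t (by norm_num : (0 : ℝ) ≤ 1 / 4)
      have e : (P ^ 4) ^ (1 / 4 : ℝ) = P := by
        rw [← Real.rpow_natCast P 4, ← Real.rpow_mul hP0.le, show ((4 : ℕ) : ℝ) * (1 / 4 : ℝ) = ((1 : ℕ) : ℝ) by norm_num, Real.rpow_natCast, pow_one]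
      rw [e] at h; exact h
    have hx : t ^ (-(1 / 4 : ℝ)) ≤ P⁻¹ := by
      rw [Real.rpow_neg ht0.le]; exact inv_anti₀ hP0 hPt
    have hPt2 : P ^ 2 ≤ t ^ (1 / 2 : ℝ) := by
      have h := Real.rpow_le_rpow (by positivity) hP4t (by norm_num : (0 : ℝ) ≤ 1 / 2)
      have e : (P ^ 4) ^ (1 / 2 : ℝ) = P ^ 2 := by
        rw [← Real.rpow_natCast P 4, ← Real.rpow_mul hP0.le, show ((4 : ℕ) : ℝ) * (1 / 2 : ℝ) = ((2 : ℕ) : ℝ) by norm_num, Real.rpow_natCast]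
      rw [e] at h; exact h
    have hr : K₂ * (L : ℝ) ^ k₂ * (1 / τ) ^ k₂ * t ^ (-(1 / 2 : ℝ)) ≤ P⁻¹ := by
      rw [Real.rpow_neg ht0.le]
      calc K₂ * (L : ℝ) ^ k₂ * (1 / τ) ^ k₂ * (t ^ (1 / 2 : ℝ))⁻¹ ≤ P * (P ^ 2)⁻¹ :=
            mul_le_mul hr_le (inv_anti₀ (by positivity) hPt2) (by positivity) hP0.le
        _ = P⁻¹ := by rw [pow_two, mul_inv, ← mul_assoc, mul_inv_cancel₀ hP0.ne', one_mul]
    have h2P : P⁻¹ + P⁻¹ ≤ 1 / (20000 * (L : ℝ) ^ 4) := by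
      have h40 : 40000 * (L : ℝ) ^ 4 ≤ P := by
        rw [hP]
        calc 40000 * (L : ℝ) ^ 4 = 40000 * (L : ℝ) ^ 4 * 1 := (mul_one _).symm
          _ ≤ D * (L : ℝ) ^ d * τ⁻¹ ^ k₂ :=
              mul_le_mul (mul_le_mul hD1 (pow_le_pow_right₀ hL1 (by omega)) (by positivity) (by linarith)) hτk (by norm_num) (by positivity)
      have hPi : P⁻¹ ≤ 1 / (40000 * (L : ℝ) ^ 4) := by
        rw [← one_div]; exact one_div_le_one_div_of_le (by positivity) h40
      calc P⁻¹ + P⁻¹ ≤ 1 / (40000 * (L : ℝ) ^ 4) + 1 / (40000 * (L : ℝ) ^ 4) := add_le_add hPi hPi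
        _ = 1 / (20000 * (L : ℝ) ^ 4) := by ring
    linarith
  exact ⟨ht1, hii, hiii, hiv⟩

/-! ## §2 One good sign pattern -/

set_option maxHeartbeats 800000 in
/-- ★★ **THE BULK STIFFNESS WITH SURPLUS FOR ONE GOOD SIGN PATTERN** at fixed `L`, cut `0 < τ ≤ ½` and `b` above the threshold `P⁴`:
`(κ_L + 1∕16)·∫_{HubBulk τ} I(·,ε;b) ≤ b·∫_{HubBulk τ} E(·,ε;b)`. [cite: Griffiths1964] [cite: Luscher1983, §2] -/
theorem bulk_stiff_sur_sign {K₂ : ℝ} (hK₂ : 0 < K₂) {k₂ : ℕ}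
    (hS2 : ∀ (ψ₀ b : ℝ), 0 < ψ₀ → ψ₀ ≤ 1 → (K₂ * (L : ℝ) ^ k₂ * (1 / ψ₀) ^ k₂) ^ 2 ≤ b → ∀ a : ℍ, a ∈ HubBulk ψ₀ → ∀ ε : GnoSign L, GoodSign ε →
      |(∫ η : GnoCoord L, Real.exp (-(b * gnoDeficit z₀ (fun _ => 1) a ε η)) * gnoDensity η) - (2 * Real.pi / b) ^ alpha L * ∫ p : ℝ × ℝ, mbDensity a ε p| ≤
        K₂ * (L : ℝ) ^ k₂ * (1 / ψ₀) ^ k₂ * b ^ (-(1 / 2 : ℝ)) * ((2 * Real.pi / b) ^ alpha L * ∫ p : ℝ × ℝ, mbDensity a ε p) +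
          (∫ η : GnoCoord L, gnoDensity η) * Real.exp (-(b * (ψ₀ / (K₂ * (L : ℝ) ^ k₂)) ^ k₂)))
    {ε : GnoSign L} (hε : GoodSign ε) {τ : ℝ} (hτ : 0 < τ) (hτ1 : τ ≤ 1 / 2) {b : ℝ}
    (hb : (40000 * (K₂ + 1) ^ (k₂ + 1) *
      ((|Real.log (coneMeasure.real (HubBulk (1 / 2)))| + |Real.log (coneConst ^ 3 / 64)| + 183620 * (L : ℝ) ^ 8) + 40) *
        (L : ℝ) ^ (12 + k₂ + k₂ * k₂) * τ⁻¹ ^ k₂) ^ 4 ≤ b) :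
    (stiffKappa L (1 / 8) + 1 / 16) * ∫ a in HubBulk τ, hubIntegral a ε b ∂coneMeasure ≤ b * ∫ a in HubBulk τ, hubActionIntegral a ε b ∂coneMeasure := by
  have hL1 : (1 : ℝ) ≤ L := by exact_mod_cast NeZero.one_le
  have hL0 : (0 : ℝ) < L := by linarith
  set A : ℝ := |Real.log (coneMeasure.real (HubBulk (1 / 2)))| + |Real.log (coneConst ^ 3 / 64)| + 183620 * (L : ℝ) ^ 8 with hAdef
  have hA0 : 0 ≤ A := by positivity
  have hh0 : (0 : ℝ) < 1 / (40 * (L : ℝ) ^ 4) := by positivity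
  have hh1 : (1 : ℝ) ≤ 1 + 1 / (40 * (L : ℝ) ^ 4) := by linarith
  -- thresholds at `b` and at `(1+h)b`
  have hb' : (40000 * (K₂ + 1) ^ (k₂ + 1) * (A + 40) * (L : ℝ) ^ (12 + k₂ + k₂ * k₂) * τ⁻¹ ^ k₂) ^ 4 ≤ (1 + 1 / (40 * (L : ℝ) ^ 4)) * b :=
    hb.trans (le_mul_of_one_le_left (le_trans (by positivity) hb) hh1)
  obtain ⟨hb1, hbii, hbiii, hbiv⟩ := bulk_thresholds (L := L) hK₂ hA0 hτ hτ1 hL1 hb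
  obtain ⟨hb1', hbii', hbiii', hbiv'⟩ := bulk_thresholds (L := L) hK₂ hA0 hτ hτ1 hL1 hb'
  have hb0 : 0 < b := by linarith
  -- the two-sided laws
  obtain ⟨hZpos, hlow, -⟩ := bulk_logLaw hK₂ hS2 hε hτ hτ1 hb1 hbii hbiii (hbiv.trans (by
    have : (0 : ℝ) < 20000 * (L : ℝ) ^ 4 := by positivity
    rw [div_le_iff₀ this]; nlinarith [one_le_pow₀ (n := 4) hL1]))
  obtain ⟨-, -, hup⟩ := bulk_logLaw hK₂ hS2 hε hτ hτ1 hb1' hbii' hbiii' (hbiv'.trans (by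
    have : (0 : ℝ) < 20000 * (L : ℝ) ^ 4 := by positivity
    rw [div_le_iff₀ this]; nlinarith [one_le_pow₀ (n := 4) hL1]))
  -- the region in the chart measure
  haveI := isFiniteMeasure_chartMeasure (L := L)
  have hRpos := chartMeasure_bulk_ne_zero (L := L) hτ1
  have hRfin : chartMeasure L (HubBulk τ ×ˢ (univ : Set (GnoCoord L))) ≠ ⊤ := measure_ne_top _ _
  obtain ⟨B, -, hB⟩ := exists_abs_gnoDeficit_le (L := L)
  have hF : Measurable fun x : ℍ × GnoCoord L => gnoDeficit z₀ (fun _ => 1) x.1 ε x.2 := measurable_gnoDeficit_uncurry z₀ (fun _ => 1) ε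
  have he0 : (0 : ℝ) ≤ alpha L := by
    rw [show alpha L = 9 * (L : ℝ) ^ 4 - 1 from by unfold alpha; exact finrank_gnoFibre_real_div_two]; nlinarith [one_le_pow₀ (n := 4) hL1]
  -- the chart-measure forms of `Z(b)`, `Z((1+h)b)`, `E(b)`
  have eZ : ∫ x in HubBulk τ ×ˢ (univ : Set (GnoCoord L)), Real.exp (-b * gnoDeficit z₀ (fun _ => 1) x.1 ε x.2) ∂chartMeasure L =
      ∫ a in HubBulk τ, hubIntegral a ε b ∂coneMeasure := by
    simp only [neg_mul]; exact bulk_exp_chart_eq hb0.le ε τ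
  have eZ' : ∫ x in HubBulk τ ×ˢ (univ : Set (GnoCoord L)), Real.exp (-((1 + 1 / (40 * (L : ℝ) ^ 4)) * b) * gnoDeficit z₀ (fun _ => 1) x.1 ε x.2)
      ∂chartMeasure L = ∫ a in HubBulk τ, hubIntegral a ε ((1 + 1 / (40 * (L : ℝ) ^ 4)) * b) ∂coneMeasure := by
    simp only [neg_mul]; exact bulk_exp_chart_eq (by positivity) ε τ
  have eE : ∫ x in HubBulk τ ×ˢ (univ : Set (GnoCoord L)), gnoDeficit z₀ (fun _ => 1) x.1 ε x.2 * Real.exp (-b * gnoDeficit z₀ (fun _ => 1) x.1 ε x.2)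
      ∂chartMeasure L = ∫ a in HubBulk τ, hubActionIntegral a ε b ∂coneMeasure := by
    simp only [neg_mul]; exact bulk_action_chart_eq hb0.le ε τ
  -- LEAD's secant step
  have hst := setStiffness_of_twoSided_logLaplace (chartMeasure L) hRpos hRfin hF (fun x => hB x.1 ε x.2) hb0 hh0 he0
    (C := alpha L * Real.log (2 * Real.pi) + Real.log (∫ a in HubBulk τ, (∫ p : ℝ × ℝ, mbDensity (L := L) a ε p) ∂coneMeasure))
    (E₁ := 2 * (K₂ * (L : ℝ) ^ k₂ * (1 / τ) ^ k₂ * b ^ (-(1 / 2 : ℝ)) + b ^ (-(1 / 4 : ℝ))))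
    (E₂ := K₂ * (L : ℝ) ^ k₂ * (1 / τ) ^ k₂ * ((1 + 1 / (40 * (L : ℝ) ^ 4)) * b) ^ (-(1 / 2 : ℝ)) +
      ((1 + 1 / (40 * (L : ℝ) ^ 4)) * b) ^ (-(1 / 4 : ℝ)))
    (by rw [eZ]; exact hlow) (by rw [eZ']; exact hup)
  rw [eZ, eE] at hst
  -- the budget
  have hEle : 2 * (K₂ * (L : ℝ) ^ k₂ * (1 / τ) ^ k₂ * b ^ (-(1 / 2 : ℝ)) + b ^ (-(1 / 4 : ℝ))) +
      (K₂ * (L : ℝ) ^ k₂ * (1 / τ) ^ k₂ * ((1 + 1 / (40 * (L : ℝ) ^ 4)) * b) ^ (-(1 / 2 : ℝ)) + ((1 + 1 / (40 * (L : ℝ) ^ 4)) * b) ^ (-(1 / 4 : ℝ))) ≤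
        3 / (20000 * (L : ℝ) ^ 4) := by
    have e3 : 3 / (20000 * (L : ℝ) ^ 4) = 2 * (1 / (20000 * (L : ℝ) ^ 4)) + 1 / (20000 * (L : ℝ) ^ 4) := by ring
    rw [e3]
    exact add_le_add (mul_le_mul_of_nonneg_left hbiv (by norm_num)) hbiv'
  have hbudget := stiff_budget (L := L) hEle
  have hZ0 : 0 ≤ ∫ a in HubBulk τ, hubIntegral a ε b ∂coneMeasure := hZpos.le
  exact le_trans (mul_le_mul_of_nonneg_right hbudget hZ0) hst

/-! ## §3 ★★★ The stub -/

/-- ★★★ **`stub_bulk_stiff_sur` OF SKELETON ➎ (HOME `fcl-p3-g47-SectorStiffnessSkeleton.lean`) VERBATIM — the bulk region carries the window stiffness with surplus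
`1∕16`**: `∃ K > 0, k, τ₀ ∈ (0, ½]`, for every `L`, every cut `0 < τ ≤ τ₀∕L^k` and every `b ≥ K·L^k·τ^{−k}`,
`(stiffKappa L (1∕8) + 1∕16)·Σ_good ∫_{HubBulk τ} I ≤ b·Σ_good ∫_{HubBulk τ} E`.  UNCONDITIONAL (w2 g59 ✓`bulk_fibred_plane` ∕ S3-on-bulk, LEAD g98 ✓`setStiffness_of_twoSided_logLaplace`).
[cite: Luscher1983, §2] [cite: Griffiths1964] -/
theorem bulk_stiff_sur : ∃ K : ℝ, 0 < K ∧ ∃ k : ℕ, ∃ τ₀ : ℝ, 0 < τ₀ ∧ τ₀ ≤ 1 / 2 ∧ ∀ (L : ℕ) [NeZero L] (τ : ℝ), 0 < τ → τ ≤ τ₀ / (L : ℝ) ^ k →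
    ∀ b : ℝ, K * (L : ℝ) ^ k * τ⁻¹ ^ k ≤ b →
      (stiffKappa L (1 / 8) + 1 / 16) * ∑ ε ∈ (Finset.univ.filter fun ε : GnoSign L => GoodSign ε), ∫ a in HubBulk τ, hubIntegral a ε b ∂coneMeasure ≤
        b * ∑ ε ∈ (Finset.univ.filter fun ε : GnoSign L => GoodSign ε), ∫ a in HubBulk τ, hubActionIntegral a ε b ∂coneMeasure := by
  obtain ⟨K₂, hK₂, k₂, hS2⟩ := bulk_fibred_plane
  -- the absolute constant `A₀ = |log cone(HubBulk ½)| + |log(coneConst³/64)|`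
  set A₀ : ℝ := |Real.log (coneMeasure.real (HubBulk (1 / 2)))| + |Real.log (coneConst ^ 3 / 64)| with hA₀
  set D : ℝ := 40000 * (K₂ + 1) ^ (k₂ + 1) * (A₀ + 183620 + 40) with hD
  set d : ℕ := 20 + k₂ + k₂ * k₂ with hd
  have hD0 : 0 < D := by positivity
  refine ⟨D ^ 4, by positivity, 4 * d, 1 / 2, by norm_num, le_rfl, fun L _ τ hτ hτle b hb => ?_⟩
  have hL1 : (1 : ℝ) ≤ L := by exact_mod_cast NeZero.one_le
  have hτ1 : τ ≤ 1 / 2 := hτle.trans (div_le_self (by norm_num) (one_le_pow₀ hL1))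
  have hτi1 : 1 ≤ τ⁻¹ := by rw [le_inv_comm₀ one_pos hτ, inv_one]; linarith
  -- the per-`L` threshold `P⁴ ≤ D⁴ L^{4d} τ⁻¹^{4d} ≤ b`
  have hP : (40000 * (K₂ + 1) ^ (k₂ + 1) *
      ((|Real.log (coneMeasure.real (HubBulk (1 / 2)))| + |Real.log (coneConst ^ 3 / 64)| + 183620 * (L : ℝ) ^ 8) + 40) *
        (L : ℝ) ^ (12 + k₂ + k₂ * k₂) * τ⁻¹ ^ k₂) ^ 4 ≤ b := by
    refine le_trans ?_ hb
    have h1 : 40000 * (K₂ + 1) ^ (k₂ + 1) *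
        ((|Real.log (coneMeasure.real (HubBulk (1 / 2)))| + |Real.log (coneConst ^ 3 / 64)| + 183620 * (L : ℝ) ^ 8) + 40) *
          (L : ℝ) ^ (12 + k₂ + k₂ * k₂) * τ⁻¹ ^ k₂ ≤ D * (L : ℝ) ^ d * τ⁻¹ ^ d := by
      have hL8 : (1 : ℝ) ≤ (L : ℝ) ^ 8 := one_le_pow₀ hL1
      have hin : (|Real.log (coneMeasure.real (HubBulk (1 / 2)))| + |Real.log (coneConst ^ 3 / 64)| + 183620 * (L : ℝ) ^ 8) + 40 ≤
          (A₀ + 183620 + 40) * (L : ℝ) ^ 8 := by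
        rw [hA₀]; nlinarith [abs_nonneg (Real.log (coneMeasure.real (HubBulk (1 / 2)))), abs_nonneg (Real.log (coneConst ^ 3 / 64))]
      calc 40000 * (K₂ + 1) ^ (k₂ + 1) *
            ((|Real.log (coneMeasure.real (HubBulk (1 / 2)))| + |Real.log (coneConst ^ 3 / 64)| + 183620 * (L : ℝ) ^ 8) + 40) *
              (L : ℝ) ^ (12 + k₂ + k₂ * k₂) * τ⁻¹ ^ k₂
          ≤ 40000 * (K₂ + 1) ^ (k₂ + 1) * ((A₀ + 183620 + 40) * (L : ℝ) ^ 8) * (L : ℝ) ^ (12 + k₂ + k₂ * k₂) * τ⁻¹ ^ d := by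
            refine mul_le_mul (mul_le_mul_of_nonneg_right (mul_le_mul_of_nonneg_left hin (by positivity)) (by positivity))
              (pow_le_pow_right₀ hτi1 (by omega)) (by positivity) (by positivity)
        _ = D * (L : ℝ) ^ d * τ⁻¹ ^ d := by rw [hD, hd]; ring
    have h0 : 0 ≤ 40000 * (K₂ + 1) ^ (k₂ + 1) *
        ((|Real.log (coneMeasure.real (HubBulk (1 / 2)))| + |Real.log (coneConst ^ 3 / 64)| + 183620 * (L : ℝ) ^ 8) + 40) *
          (L : ℝ) ^ (12 + k₂ + k₂ * k₂) * τ⁻¹ ^ k₂ := by positivity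
    calc _ ≤ (D * (L : ℝ) ^ d * τ⁻¹ ^ d) ^ 4 := pow_le_pow_left₀ h0 h1 4
      _ = D ^ 4 * (L : ℝ) ^ (4 * d) * τ⁻¹ ^ (4 * d) := by rw [mul_pow, mul_pow, ← pow_mul, ← pow_mul, mul_comm d 4]
  -- sum the per-pattern inequalities
  rw [Finset.mul_sum, Finset.mul_sum]
  refine Finset.sum_le_sum fun ε hε => ?_
  rw [Finset.mem_filter] at hε
  exact bulk_stiff_sur_sign hK₂ (hS2 L) hε.2 hτ hτ1 hP

end Summit.QuantumFields.YangMills.Theorems.SwapVirialDeficit.SectorLaplace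

end
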